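import Literature.AlgebraicGeometry.Milne1999.SpecialLefschetzGroupInvariantsCMProducts
import Literature.AlgebraicGeometry.Milne1999.TateFromCodesHCOfHSimplePos
import Literature.AlgebraicGeometry.Motives.AbelianVarietySimpleFactorsUnique
import Literature.AlgebraicGeometry.Motives.AbelianVarietyKernelComponent
import HarnessLib

/-!
# Milne 1999, Theorem 3.2 / Cor. 4.5 for EVERY complex abelian variety of CM type: the
# `S(A)`-invariants of `H^{2p}(A(ℂ); ℂ)` are Lefschetz (divisor) classes

Family `hodge`, layer `Literature/AlgebraicGeometry/Milne1999`, namespace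
`Literature.AlgebraicGeometry.Milne1999` (D-0022). THEOREMS ONLY (no definition, no named fact; D-0026).
Written for the cell `pub-hodgecm2` (COR-CM), seat `lit-milne`, binder table `HOME/lit/milne.md` rows M2/M4.
The last of three files: `Milne1999/LefschetzCentraliserBiproducts` (Milne's product divisor on a finite
biproduct), `Milne1999/SpecialLefschetzGroupInvariantsCMProducts` (Lemma 3.8 with multiplicities on
`B = ⨁ᵢ A_{cls i}`), and this file, which performs Milne's reduction "Let `A₁, …, A_s` be a set of
representatives for the simple isogeny factors of `A`, so that there exists an isogeny
`A₁^{r₁} × ⋯ × A_s^{r_s} → A`" (Prop. 1.1) for an ARBITRARY complex abelian variety of CM type, on the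
tree's carriers: Poincaré's complete reducibility (the tree's hereditary decomposition into simple abelian
subvarieties of positive dimension), CM type of the simple factors (Milne 1999b p. 54, the tree's
`isOfCMType_of_isSimple_of_isClosedImmersion`), a CM-typed model of each simple factor (Deligne 1982 I
Prop. 5.1, the tree's `exists_isCMTyped_isIsogenous_of_isSimple`), regrouping of the factors by isogeny
class (`Hom = 0` between non-isogenous simple abelian varieties, Mumford §19 Cor. 2 of Thm. 1), and
transport along the resulting isogeny.  CONCLUSION: the conclusion of the cited record
`Milne1999_specialLefschetzGroup_invariants_le` (Cor. 4.5 with Thm. 4.4 and Thm. 3.2, stated for every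
complex abelian variety) is a THEOREM of the tree for every complex abelian variety OF CM TYPE — the torus
case of Thm. 3.2, "so much more elementary than the general case" (p. 656); what remains cited is the
non-CM case (Prop. 3.6: invariant theory of `Sp`, `O`, `GL`).

## Source, verbatim

J. S. Milne, *Lefschetz classes on abelian varieties*, Duke Math. J. 96 (1999) 639–675
[`paper:doi-10-1215-s0012-7094-99-09620-5`, held; PDF page = printed page − 638]:

* §1 p. 643, Prop. 1.1 (p0005 L27–L31): "Let `A₁, …, A_s` be a set of representatives for the simple isogeny
  factors of `A`, so that there exists an isogeny `A₁^{r₁} × ⋯ × A_s^{r_s} → A` for some `rᵢ > 0`. Any such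
  isogeny induces an isomorphism `C(A₁) × ⋯ × C(A_s) → C(A)` of `k`-algebras with involution, which is
  independent of the choice of the isogeny."
* Thm. 3.2 (p. 653), Lemma 3.8 and p. 657 (the torus case), Cor. 4.5 (p. 659): as quoted in
  `Milne1999/SpecialLefschetzGroupInvariantsCMProducts`.

J. S. Milne, *Lefschetz motives and the Tate conjecture*, Compositio Math. 117 (1999), §2 p. 54: "A simple
Abelian variety `A` over `C` is said to be of CM-type if `End⁰(A)` is a field (necessarily CM) of degree
`2 dim A` over `ℚ`, and an arbitrary Abelian variety over `C` is said to be of CM-type if all its simple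
isogeny factors are of CM-type."

## What is proved

* `exists_isIsogeny_to_biproduct_of_isProductOf` — a finite product tree `P` (`IsProductOf Q P`) is
  isomorphic (an isogeny `P ⟶ ⨁ᵢ Sᵢ`) to a finite biproduct of its atoms, all satisfying `Q`.
* `exists_isIsogeny_to_biproduct_simple_of_isOfCMType` — every complex abelian variety `X` of CM type with
  `0 < dim X` admits an isogeny `X ⟶ ⨁_{i<m+1} Sᵢ` onto a biproduct of SIMPLE abelian varieties of CM type of
  positive dimension (Poincaré + Milne p. 54).
* `exists_isIsogeny_to_biproduct_of_classes_of_isOfCMType` — regrouping: an isogeny `X ⟶ ⨁ᵢ A_{cls i}` onto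
  a biproduct of copies of pairwise `Hom`-orthogonal CM REALISATIONS with commutative endomorphism rings
  (`cls` = isogeny class of the `i`-th factor, `A_c` a CM-typed model of a representative).
* **`specialLefschetzGroup_invariants_le_of_isOfCMType`** — for every complex abelian variety `X` of CM type
  with `0 < dim X`, every class `x ∈ H^{2p}(X(ℂ); ℂ)` fixed by `specialLefschetzGroup (dim X) X.X` lies in
  `Dᵖ_hom(X)_ℂ = divisorClassesSpan X.X (dim X) p`; `setOf_forall_apply_eq_self_eq_divisorClassesSpan_of_isOfCMType`
  (Cor. 4.5 as an equality of sets) and `isDivisorGenerated_of_hodgeGroup_eq_specialLefschetzGroup_of_isOfCMType`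
  (Prop. 4.8 (c) ⇒ (a), record-free, for every CM abelian variety); `specialLefschetzGroup_invariants_le_powSucc_of_isOfCMType`
  (all powers `X^{N+1}`, Thm. 3.2's "`A^r`, all `r`").

## References

* [Milne1999LefschetzClasses] J. S. Milne, Lefschetz classes on abelian varieties, Duke Math. J. 96 (1999)
  639–675: §1 p. 643 and Prop. 1.1, Thm. 3.2, Lemma 3.8 and p. 657, Thm. 4.4, Cor. 4.5, Prop. 4.8.
* [Milne1999] J. S. Milne, Lefschetz motives and the Tate conjecture, Compositio Math. 117 (1999), §2 p. 54.
* [MumfordAV1970] D. Mumford, Abelian Varieties, §19 Thm. 1, Cor. 1, Cor. 2 (pp. 173–174).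
* [Deligne1982HodgeCycles] P. Deligne, Hodge cycles on abelian varieties, LNM 900, I Prop. 5.1 and §5.
* [Shimura1998] G. Shimura, Abelian Varieties with Complex Multiplication and Modular Functions (1998),
  §5.1 Props. 3–6, §6.2 Thm. 4 (3).
-/

noncomputable section

open CategoryTheory CategoryTheory.Limits NumberField
open Literature.AlgebraicTopology.SingularHomology
open Literature.AlgebraicGeometry.HodgeTheory
open Literature.AlgebraicGeometry.Motives
open Literature.AlgebraicGeometry.ComplexMultiplication (IsCMTypeRealisation)
open Literature.AlgebraicGeometry.VanGeemen1994 (hodgeClassSpan)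
open Literature.Barriers.HodgeConjecture (divisorClassesSpan)
open Literature.Geometry.Kaehler (lefschetzPow)

namespace Literature.AlgebraicGeometry.Milne1999

/-! ### §1 Finite product trees are finite biproducts -/

section Flatten

/-- The family on `J₁ ⊕ J₂` gluing `C₁` and `C₂` (pattern matching, so that it computes on constructors).
[cite: MumfordAV1970, §19] -/
private abbrev sumFamily {X : Type*} {J₁ J₂ : Type} (C₁ : J₁ → X) (C₂ : J₂ → X) : J₁ ⊕ J₂ → X :=
  fun j => match j with
    | Sum.inl j => C₁ j
    | Sum.inr j => C₂ j

/-- **`(⨁ C₁) × (⨁ C₂) ≅ ⨁ (C₁ ⊔ C₂)`**: the binary product of two finite biproducts of abelian varieties is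
isomorphic to the biproduct over the sum of the index types (universal properties), as a pair of inverse
homomorphisms. [cite: MumfordAV1970, §19 (Hom(C, A × B) = Hom(C, A) ⊕ Hom(C, B))] -/
private theorem exists_prod_biproduct_iso {J₁ J₂ : Type} [Fintype J₁] [Fintype J₂] [DecidableEq J₁]
    [DecidableEq J₂] (C₁ : J₁ → AbelianVariety ℂ) (C₂ : J₂ → AbelianVariety ℂ) :
    ∃ (u : (⨁ C₁).prod (⨁ C₂) ⟶ ⨁ (sumFamily C₁ C₂)) (v : ⨁ (sumFamily C₁ C₂) ⟶ (⨁ C₁).prod (⨁ C₂)),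
      u ≫ v = 𝟙 _ ∧ v ≫ u = 𝟙 _ := by
  refine ⟨biproduct.lift fun j => match j with
      | Sum.inl j => AbelianVariety.fst _ _ ≫ biproduct.π C₁ j
      | Sum.inr j => AbelianVariety.snd _ _ ≫ biproduct.π C₂ j,
    AbelianVariety.prodLift (biproduct.lift fun j => biproduct.π (sumFamily C₁ C₂) (Sum.inl j))
      (biproduct.lift fun j => biproduct.π (sumFamily C₁ C₂) (Sum.inr j)), ?_, ?_⟩
  · refine AbelianVariety.prod_hom_ext ?_ ?_
    · rw [Category.assoc, AbelianVariety.prodLift_fst, Category.id_comp]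
      refine biproduct.hom_ext _ _ fun j => ?_
      rw [Category.assoc, biproduct.lift_π, biproduct.lift_π]
    · rw [Category.assoc, AbelianVariety.prodLift_snd, Category.id_comp]
      refine biproduct.hom_ext _ _ fun j => ?_
      rw [Category.assoc, biproduct.lift_π, biproduct.lift_π]
  · refine biproduct.hom_ext _ _ fun j => ?_
    rw [Category.assoc, biproduct.lift_π, Category.id_comp]
    rcases j with j | j
    · change AbelianVariety.prodLift _ _ ≫ AbelianVariety.fst _ _ ≫ biproduct.π C₁ j = _
      rw [← Category.assoc, AbelianVariety.prodLift_fst, biproduct.lift_π]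
    · change AbelianVariety.prodLift _ _ ≫ AbelianVariety.snd _ _ ≫ biproduct.π C₂ j = _
      rw [← Category.assoc, AbelianVariety.prodLift_snd, biproduct.lift_π]

/-- **A finite product tree is a finite biproduct of its atoms**: if `P` is an iterated binary product of
abelian varieties satisfying `Q` (`IsProductOf Q P`), there are `m`, a family `S : Fin (m+1) → _` of atoms
all satisfying `Q`, and an isogeny (indeed an isomorphism) `P ⟶ ⨁ᵢ Sᵢ` (by induction along the tree:
`(⨁ S₁) × (⨁ S₂) ≅ ⨁ (S₁ ⊔ S₂)`, re-indexed by `Fin (m₁+1) ⊕ Fin (m₂+1) ≃ Fin (m₁+m₂+2)`).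
[cite: MumfordAV1970, §19] [cite: Milne1986AbelianVarieties, §12 p. 122] -/
theorem exists_isIsogeny_to_biproduct_of_isProductOf {Q : AbelianVariety ℂ → Prop} {P : AbelianVariety ℂ}
    (hP : AbelianVariety.IsProductOf Q P) :
    ∃ (m : ℕ) (S : Fin (m + 1) → AbelianVariety ℂ) (e : P ⟶ ⨁ S),
      (∀ i, Q (S i)) ∧ AbelianVariety.IsIsogeny e := by
  classical
  induction hP with
  | @atom A hA =>
    exact ⟨0, fun _ => A, biproduct.ι (fun _ : Fin 1 => A) 0, fun _ => hA, isIsogeny_biproduct_ι_fin_one _⟩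
  | @prod P₁ P₂ _ _ ih₁ ih₂ =>
    obtain ⟨m₁, S₁, e₁, hS₁, he₁⟩ := ih₁
    obtain ⟨m₂, S₂, e₂, hS₂, he₂⟩ := ih₂
    obtain ⟨u, v, huv, hvu⟩ := exists_prod_biproduct_iso S₁ S₂
    have hu : AbelianVariety.IsIsogeny u :=
      AbelianVariety.isIsogeny_of_comp_eq_of_comp_eq (AbelianVariety.isIsogeny_id _)
        (AbelianVariety.isIsogeny_id _) hvu huv
    let ε : Fin (m₁ + 1 + (m₂ + 1)) ≃ Fin (m₁ + 1) ⊕ Fin (m₂ + 1) := finSumFinEquiv.symm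
    let r : (⨁ (sumFamily S₁ S₂ ∘ ε)) ≅ ⨁ (sumFamily S₁ S₂) := biproduct.reindex ε (sumFamily S₁ S₂)
    refine ⟨m₁ + 1 + m₂, sumFamily S₁ S₂ ∘ ε, AbelianVariety.prodMap e₁ e₂ ≫ u ≫ r.inv, fun i => ?_, ?_⟩
    · change Q (sumFamily S₁ S₂ (ε i))
      rcases ε i with j | j
      · exact hS₁ j
      · exact hS₂ j
    · exact AbelianVariety.isIsogeny_comp (AbelianVariety.isIsogeny_prodMap he₁ he₂)
        (AbelianVariety.isIsogeny_comp hu (AbelianVariety.isIsogeny_hom_of_iso r.symm))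

end Flatten

/-! ### §2 Every complex abelian variety of CM type is isogenous to a biproduct of simple CM factors -/

section Decomposition

/-- **Poincaré decomposition of a CM abelian variety into simple CM factors, as a biproduct**: every complex
abelian variety `X` of CM type (`IsOfCMType X`) with `0 < dim X` admits an isogeny `X ⟶ ⨁_{i<m+1} Sᵢ` onto a
finite biproduct of SIMPLE abelian varieties of CM type of positive dimension ("an arbitrary Abelian variety
over `C` is said to be of CM-type if all its simple isogeny factors are of CM-type"; the tree's hereditary
Poincaré decomposition `exists_isogeny_from_productOf_simple_pos_of_hereditary` over the inherited property
"is an abelian subvariety of `X`", CM type of simple abelian subvarieties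
`isOfCMType_of_isSimple_of_isClosedImmersion`, symmetry of isogeny, §1).
[cite: MumfordAV1970, §19 Thm. 1 and Cor. 1 (pp. 173–174)] [cite: Milne1999, §2 p. 54]
[cite: Deligne1982HodgeCycles, §5 Prop. 5.1] -/
theorem exists_isIsogeny_to_biproduct_simple_of_isOfCMType {X : AbelianVariety ℂ} (hX0 : 0 < X.dim)
    (hCM : IsOfCMType X) :
    ∃ (m : ℕ) (S : Fin (m + 1) → AbelianVariety ℂ) (f : X ⟶ ⨁ S),
      (∀ i, AbelianVariety.IsSimple (S i) ∧ 0 < (S i).dim ∧ IsOfCMType (S i)) ∧ AbelianVariety.IsIsogeny f := by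
  obtain ⟨P, g, hP, hg⟩ :=
    AbelianVariety.exists_isogeny_from_productOf_simple_pos_of_hereditary
      (fun B => ∃ f : B ⟶ X, _root_.AlgebraicGeometry.IsClosedImmersion (AbelianVariety.Hom.toSchemeHom f))
      (fun B C f hf ⟨i, hi⟩ => ⟨f ≫ i, by
        haveI := hf; haveI := hi
        change _root_.AlgebraicGeometry.IsClosedImmersion
          (AbelianVariety.Hom.toSchemeHom f ≫ AbelianVariety.Hom.toSchemeHom i)
        infer_instance⟩)
      X ⟨𝟙 X, by change _root_.AlgebraicGeometry.IsClosedImmersion (𝟙 X.X.left); infer_instance⟩ hX0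
  have hP' : AbelianVariety.IsProductOf
      (fun B => AbelianVariety.IsSimple B ∧ 0 < B.dim ∧ IsOfCMType B) P :=
    hP.mono fun B ⟨hs, hB0, i, hi⟩ => by
      haveI := hi
      exact ⟨hs, hB0, ComplexMultiplication.isOfCMType_of_isSimple_of_isClosedImmersion hCM hs i⟩
  obtain ⟨m, S, e, hS, he⟩ := exists_isIsogeny_to_biproduct_of_isProductOf hP'
  obtain ⟨g', hg'⟩ := AbelianVariety.IsIsogenous.symm' (A := P) (B := X) ⟨g, hg⟩
  exact ⟨m, S, g' ≫ e, hS, AbelianVariety.isIsogeny_comp hg' he⟩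

/-- `Hom(S, S') = 0` between non-isogenous SIMPLE complex abelian varieties (every non-zero homomorphism
between simple abelian varieties is an isogeny). [cite: MumfordAV1970, §19 Cor. 2 of Thm. 1 (p. 174)] -/
theorem hom_eq_zero_of_isSimple_of_not_isIsogenous {S S' : AbelianVariety ℂ} (hS : AbelianVariety.IsSimple S)
    (hS' : AbelianVariety.IsSimple S') (h : ¬ AbelianVariety.IsIsogenous S S') (f : S ⟶ S') : f = 0 := by
  rcases AbelianVariety.isIsogenous_or_forall_eq_zero
      (AbelianVariety.hsimple_of_isAlgClosed ℂ S S' hS hS') with h' | h'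
  · exact absurd h' h
  · exact h' f

/-- **Milne's regrouping `A₁^{r₁} × ⋯ × A_s^{r_s} → A` on the tree's carriers**: every complex abelian variety
`X` of CM type with `0 < dim X` admits an isogeny `X ⟶ ⨁ᵢ A_{cls i}` onto a biproduct of copies of CM
REALISATIONS `(A_c, ι_c, θ_c)` of CM types `(K_c; Φ_c)` indexed by a finite type `C` of classes, with
`Hom(A_c, A_{c'}) = 0` for `c ≠ c'` and every `End(A_c)` commutative: `C` = the isogeny classes of the simple
factors `Sᵢ` of §2, `A_c` a CM-typed model of a representative (`exists_isCMTyped_isIsogenous_of_isSimple`;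
simple, hence with commutative `End`, `comp_comm_of_isSimple_of_isOfCMType`), the isogeny `⊕ᵢ (Sᵢ → A_{cls i})`
componentwise (`isIsogeny_biproduct_map`). [cite: Milne1999LefschetzClasses, §1 Prop. 1.1 (p. 643)]
[cite: MumfordAV1970, §19 Cor. 1 and Cor. 2 of Thm. 1] [cite: Milne1999, §2 p. 54] -/
theorem exists_isIsogeny_to_biproduct_of_classes_of_isOfCMType {X : AbelianVariety ℂ} (hX0 : 0 < X.dim)
    (hCM : IsOfCMType X) :
    ∃ (C : Type) (_ : Fintype C) (K' : C → Type) (_ : ∀ c, Field (K' c)) (_ : ∀ c, NumberField (K' c))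
      (_ : ∀ c, IsCMField (K' c)) (Φ' : ∀ c, CMType (K' c)) (A' : C → AbelianVariety ℂ)
      (ι' : ∀ c, 𝓞 (K' c) →+* End (A' c)) (θ' : ∀ c, K' c →+* Module.End ℂ (complexBetti (A' c).X 1))
      (m : ℕ) (cls : Fin (m + 1) → C) (f : X ⟶ ⨁ fun i => A' (cls i)),
      (∀ c, IsCMTypeRealisation (Φ' c) (A' c) (ι' c) (θ' c)) ∧
      (∀ c c', c ≠ c' → ∀ g : A' c ⟶ A' c', g = 0) ∧ (∀ (c) (g g' : A' c ⟶ A' c), g ≫ g' = g' ≫ g) ∧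
      AbelianVariety.IsIsogeny f := by
  classical
  obtain ⟨m, S, f₀, hS, hf₀⟩ := exists_isIsogeny_to_biproduct_simple_of_isOfCMType hX0 hCM
  -- the isogeny classes of the simple factors
  let r : Setoid (Fin (m + 1)) :=
    { r := fun i j => AbelianVariety.IsIsogenous (S i) (S j)
      iseqv :=
        { refl := fun i => AbelianVariety.IsIsogenous.refl (S i)
          symm := fun h => AbelianVariety.IsIsogenous.symm' h
          trans := fun h h' => h.trans h' } }
  -- a CM-typed model of every simple factor
  have hmodel : ∀ i : Fin (m + 1), ∃ B : AbelianVariety ℂ, IsCMTyped B ∧ AbelianVariety.IsIsogenous (S i) B :=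
    fun i => exists_isCMTyped_isIsogenous_of_isSimple (S i) (hS i).1 (hS i).2.1 (hS i).2.2
  choose B hBT hSB using hmodel
  have hBdata : ∀ i : Fin (m + 1), ∃ (K : Type) (_ : Field K) (_ : NumberField K) (_ : IsCMField K)
      (Φ : CMType K) (ι : 𝓞 K →+* End (B i)) (θ : K →+* Module.End ℂ (complexBetti (B i).X 1)),
      IsCMTypeRealisation Φ (B i) ι θ := fun i => by
    obtain @⟨K, _, _, _, Φ, _, ι, θ, h⟩ := hBT i
    exact ⟨K, inferInstance, inferInstance, inferInstance, Φ, ι, θ, h⟩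
  choose K iF iN iC Φ ι θ hB using hBdata
  -- classes and representatives
  let C := Quotient r
  let rep : C → Fin (m + 1) := Quotient.out
  have hrep : ∀ i : Fin (m + 1), AbelianVariety.IsIsogenous (S i) (S (rep (Quotient.mk r i))) := fun i =>
    AbelianVariety.IsIsogenous.symm' (Quotient.exact (Quotient.out_eq (Quotient.mk r i)) : r.r _ _)
  refine ⟨C, inferInstance, fun c => K (rep c), fun c => iF (rep c), fun c => iN (rep c), fun c => iC (rep c),
    fun c => Φ (rep c), fun c => B (rep c), fun c => ι (rep c), fun c => θ (rep c), m, fun i => Quotient.mk r i,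
    f₀ ≫ biproduct.map fun i => Classical.choose ((hrep i).trans (hSB (rep (Quotient.mk r i)))),
    fun c => hB (rep c), ?_, ?_, ?_⟩
  · -- `Hom(A_c, A_{c'}) = 0` for distinct classes
    intro c c' hcc' g
    have hBs : ∀ i, AbelianVariety.IsSimple (B i) := fun i => (hS i).1.of_isIsogenous (hSB i)
    refine hom_eq_zero_of_isSimple_of_not_isIsogenous (hBs _) (hBs _) (fun hiso => hcc' ?_) g
    have h1 : AbelianVariety.IsIsogenous (S (rep c)) (S (rep c')) :=
      ((hSB (rep c)).trans hiso).trans (AbelianVariety.IsIsogenous.symm' (hSB (rep c')))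
    calc c = Quotient.mk r (rep c) := (Quotient.out_eq c).symm
      _ = Quotient.mk r (rep c') := Quotient.sound h1
      _ = c' := Quotient.out_eq c'
  · -- `End(A_c)` is commutative
    intro c g g'
    exact comp_comm_of_isSimple_of_isOfCMType ((hS _).1.of_isIsogenous (hSB _))
      ((hBT _).isOfCMType) g g'
  · exact AbelianVariety.isIsogeny_comp hf₀ (isIsogeny_biproduct_map fun i =>
      Classical.choose_spec ((hrep i).trans (hSB (rep (Quotient.mk r i)))))

end Decomposition

/-! ### §3 Milne 1999, Thm. 3.2 / Cor. 4.5 for every complex abelian variety of CM type -/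

section Main

/-- **Milne 1999, Cor. 4.5 (with Thm. 4.4 and Thm. 3.2) — the conclusion of the record
`Milne1999_specialLefschetzGroup_invariants_le` — for EVERY complex abelian variety of CM type**
(`Milne1999.IsOfCMType X`, the binder of `HC_CM`; `0 < dim X`): every class `x ∈ H^{2p}(X(ℂ); ℂ)` fixed by
every element of `specialLefschetzGroup (dim X) X.X` lies in `Dᵖ_hom(X)_ℂ = divisorClassesSpan X.X (dim X) p`.
Proof: Milne's reduction to `A₁^{r₁} × ⋯ × A_s^{r_s}` (Prop. 1.1, §2 here) and the torus argument with
multiplicities there (`exists_polarization_invariants_le_biproduct_of_classes`, Lemma 3.8 and p. 657),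
transported along the isogeny ("`S(A)` depends only on the isogeny class", §1 p. 644;
`specialLefschetzGroup_invariants_le_of_isIsogeny_of_forall`).
[cite: Milne1999LefschetzClasses, Cor. 4.5 and p. 659, Thm. 3.2, Lemma 3.8 and p. 657, §1 p. 643–644 and Prop. 1.1]
[cite: Milne1999, §2 p. 54] [cite: MumfordAV1970, §19 Thm. 1, Cor. 1, Cor. 2] -/
theorem specialLefschetzGroup_invariants_le_of_isOfCMType {X : AbelianVariety ℂ} (hX0 : 0 < X.dim)
    (hCM : IsOfCMType X) (p : ℕ) (x : complexBetti X.X (2 * p))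
    (hx : ∀ g ∈ specialLefschetzGroup X.dim X.X, g (2 * p) x = x) :
    x ∈ divisorClassesSpan X.X X.dim p := by
  obtain ⟨C, _, K', _, _, _, Φ', A', ι', θ', m, cls, f, hA, hOrth, hComm, hf⟩ :=
    exists_isIsogeny_to_biproduct_of_classes_of_isOfCMType hX0 hCM
  exact specialLefschetzGroup_invariants_le_of_isIsogeny_biproduct_of_classes hA hOrth hComm cls hf p x hx

/-- Powers of a complex abelian variety of CM type are of CM type (`IsOfCMType.prod`, by induction on the
power). [cite: Milne1999, §2 p. 54] -/
private theorem isOfCMType_powSucc'' {X : AbelianVariety ℂ} (hCM : IsOfCMType X) :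
    ∀ N : ℕ, IsOfCMType (X.powSucc N)
  | 0 => hCM
  | N + 1 => (isOfCMType_powSucc'' hCM N).prod hCM

/-- **Milne 1999, Thm. 3.2 / Cor. 4.5 for ALL POWERS `X^{N+1}` of every complex abelian variety of CM type**
("for any abelian variety `A` over `Ω` and integer `r ≥ 0`, the `k`-algebra `H*(A^r)^{S(A)}` is generated by
divisor classes" — here `S(A^r) = S(A)` acting diagonally, §1 p. 643, in the tree's spelling
`specialLefschetzGroup (dim X^{N+1}) (X^{N+1}).X`): every class of `H^{2p}(X^{N+1}(ℂ); ℂ)` fixed by the special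
Lefschetz group of `X^{N+1}` lies in `Dᵖ_hom(X^{N+1})_ℂ` (`X^{N+1}` is again of CM type).
[cite: Milne1999LefschetzClasses, Thm. 3.2 (p. 653), §1 p. 643, Cor. 4.5 (p. 659)] [cite: Milne1999, §2 p. 54] -/
theorem specialLefschetzGroup_invariants_le_powSucc_of_isOfCMType {X : AbelianVariety ℂ} (hX0 : 0 < X.dim)
    (hCM : IsOfCMType X) (N p : ℕ) (x : complexBetti (X.powSucc N).X (2 * p))
    (hx : ∀ g ∈ specialLefschetzGroup (X.powSucc N).dim (X.powSucc N).X, g (2 * p) x = x) :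
    x ∈ divisorClassesSpan (X.powSucc N).X (X.powSucc N).dim p :=
  specialLefschetzGroup_invariants_le_of_isOfCMType (dim_powSucc_pos hX0 N) (isOfCMType_powSucc'' hCM N) p x hx

/-- **Cor. 4.5 as an equality of sets, for every complex abelian variety of CM type**: the invariants of
`specialLefschetzGroup (dim X) X.X` in `H^{2p}(X(ℂ); ℂ)` are EXACTLY `Dᵖ_hom(X)_ℂ`.
[cite: Milne1999LefschetzClasses, Cor. 4.5 (p. 659)] -/
theorem setOf_forall_apply_eq_self_eq_divisorClassesSpan_of_isOfCMType {X : AbelianVariety ℂ}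
    (hX0 : 0 < X.dim) (hCM : IsOfCMType X) (p : ℕ) :
    {x : complexBetti X.X (2 * p) | ∀ g ∈ specialLefschetzGroup X.dim X.X, g (2 * p) x = x} =
      (divisorClassesSpan X.X X.dim p : Set _) :=
  Set.Subset.antisymm (fun x hx => specialLefschetzGroup_invariants_le_of_isOfCMType hX0 hCM p x hx)
    fun _ hx _ hg => apply_eq_self_of_mem_specialLefschetzGroup hg hx

/-- **Milne Prop. 4.8, (c) ⇒ (a) on `X` itself, record-free for every complex abelian variety of CM type**: if
`Hg′(X) = S(X)` then `X` supports no exotic Hodge class (`IsDivisorGenerated X`).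
[cite: Milne1999LefschetzClasses, Prop. 4.8 and Cor. 4.5 (pp. 659–660)] -/
theorem isDivisorGenerated_of_hodgeGroup_eq_specialLefschetzGroup_of_isOfCMType {X : AbelianVariety ℂ}
    (hX0 : 0 < X.dim) (hCM : IsOfCMType X)
    (hHg : hodgeGroup X.dim X.X = specialLefschetzGroup X.dim X.X) : IsDivisorGenerated X :=
  fun p c hc hpp => specialLefschetzGroup_invariants_le_of_isOfCMType hX0 hCM p c
    fun _ hg => apply_eq_self_of_mem_hodgeGroup (hHg ▸ hg) hc hpp

end Main

end Literature.AlgebraicGeometry.Milne1999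

end
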